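import Summits.QuantumFields.BalabanUV.T4Continuum.Support.CovariantVectorCoerciveHolo
import Literature.Analysis.Complex.RungeUnits

/-!
# T⁴ programme, SUBSTRATE (shared lattice-gauge analysis library) — OPERATOR-NORM MODULI OF THE TWO-SIDED SPECIES ALONG THE EXPONENTIAL CHART:
# chart factors (`‖e^{A}R⁰ − R⁰‖ ≤ ‖A‖e^{‖A‖}`), transport differences (`(1 + δ)^ℓ − 1`), the Schur bound `‖Q(R) − Q(R′)‖ ≤ |o|·ε·n^{−d/2}`, and
# `‖Δ(R, S) − Δ(R′, S′)‖ ≤ d·‖c‖²·δ·(β + 3)` (tools for the explicit holomorphy radius, file `CovariantVectorCoerciveHoloExplicit`)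

Substrate cell `b2b-balaban-substrate-*`, seat p3 (typer NEXT gen 6 item 1(c), follower of `CovariantVectorCoerciveHolo`).  Pure operator-norm
bookkeeping ([folklore]) for p1's two-sided species (`SubstrateTransporterSpecies`: `transport`, `covDc`, `covDcA`, `covLapT`, `Qcov`, `QcovA`) at a
UNITARY reference field `R⁰`:
 * §1 chart factors: `norm_mexp_sub_one_le` (`‖e^X − 1‖ ≤ ‖X‖e^{‖X‖}`, from `Literature.Analysis.Complex.norm_exp_sub_exp_le`),
   `norm_expChart_sub_le` ∕ `norm_expChartInv_sub_le` (`≤ ‖A‖e^{‖A‖}`), `norm_expChart_le` (`≤ 1 + ‖A‖e^{‖A‖}`), `norm_of_unitary`;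
 * §2 transports and averaging: `norm_list_prod_sub_prod_aux` ∕ `norm_list_prod_le_one`, **`norm_transport_sub_transport_le`** (`‖Π R − Π R′‖ ≤ (1 + δ)^ℓ − 1`
   for `‖R′‖ ≤ 1`, `‖R − R′‖ ≤ δ` bondwise, lists of length `≤ ℓ`), `norm_transport_le_one`, `Qcov_sub_Qcov_apply`, `norm_Qcov_sub_Qcov_apply_le`,
   **`opNorm_Qcov_sub_Qcov_le`** (`‖Q(R) − Q(R′)‖ ≤ |o|·ε·(√(n^d))⁻¹`, rectangular Schur test on the `qr` pattern of `CovariantBlockAveraging`),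
   `opNorm_Qcov_le_of_norm_le_one` (`≤ (2|o| + 1)(√(n^d))⁻¹`);
 * §3 covariant differences: `opNorm_kronShift_le`, `opNorm_covDc_sub_le` ∕ `opNorm_covDcA_sub_le` (`≤ ‖c‖·δ`), `norm_one_site_le`, `opNorm_covDc_le` ∕
   `opNorm_covDcA_le` (`≤ ‖c‖(β + 1)`), **`opNorm_covLapT_sub_le`** (`‖Δ(R,S) − Δ(R′,S′)‖ ≤ d·‖c‖²·δ·(β + 3)`).

HONEST FRAMING (T4-DAG p. 1).  Finite-dimensional linear algebra ([folklore]); no estimate of any NE row; nothing printed is a hypothesis; no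
`def … : Prop`; spine 0/9 unchanged; NOT infinite volume ∕ mass gap ∕ Clay.  HONEST DEPENDENCY: continuum YM on T⁴ ⇐ BetaPertH ∧ nine spine estimates
(0/9 proved); BetaPertH ⇐ (D1) ∧ (D4) ∧ CAP+tail; G-an2-4 gates asym, D1 and NE2/3/4.  ABSOLUTE RULE kept; no `sorry`.
-/

noncomputable section

open scoped BigOperators ComplexConjugate Matrix Matrix.Norms.L2Operator Kronecker ComplexOrder

namespace Summit.QuantumFields.BalabanUV.T4Continuum.CovariantVectorChartModulus

open Literature.MathematicalPhysics.QuantumFieldTheory.Balaban1983to89.B5Prop11Plancherel (Tor fine shiftM)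
open Literature.MathematicalPhysics.QuantumFieldTheory.Balaban1983to89.B5Block118 (QvOp bpt tstep)
open Literature.MathematicalPhysics.QuantumFieldTheory.Balaban1983to89.Beta.DeltaACombesThomas (qr qr_nonneg sum_qr_row sum_qr_col)
open Summit.QuantumFields.BalabanUV.T4Continuum
open Summit.QuantumFields.BalabanUV.T4Continuum.BalabanAveragedTowerUnit (norm_entry_le_opNorm)
open Summit.QuantumFields.BalabanUV.T4Continuum.KroneckerLift (opNorm_kron_le_of_le)
open Summit.QuantumFields.BalabanUV.T4Continuum.BlockMultiplication (siteMul siteMul_sub siteMul_one opNorm_siteMul_le)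
open Summit.QuantumFields.BalabanUV.T4Continuum.BlockPairingGeometry (opNorm_shiftM_le)
open Summit.QuantumFields.BalabanUV.T4Continuum.ColourCovariantLaplacian (covDc)
open Summit.QuantumFields.BalabanUV.T4Continuum.CovariantBlockAveraging (transport ContourSystem Qcov opNorm_le_sqrt_of_schur opNorm_Qcov_sub_kron_le
  opNorm_QvOp_le)
open Summit.QuantumFields.BalabanUV.T4Continuum.CoerciveInverseTower (Coercive)
open Summit.QuantumFields.BalabanUV.T4Continuum.SubstrateTransporterSpecies
open Summit.QuantumFields.BalabanUV.T4Continuum.CovariantVectorCoercive (vecOp)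
open Summit.QuantumFields.BalabanUV.T4Continuum.CovariantVectorCoerciveHolo

variable {d : ℕ} {o : Type*} [Fintype o] [DecidableEq o] [Nonempty o]

/-! ## §1 The chart factors -/

/-- `‖e^X − 1‖ ≤ ‖X‖·e^{‖X‖}` for colour matrices. [folklore] -/
theorem norm_mexp_sub_one_le (X : Matrix o o ℂ) : ‖NormedSpace.exp X - 1‖ ≤ ‖X‖ * Real.exp ‖X‖ := by
  have h := Literature.Analysis.Complex.norm_exp_sub_exp_le X 0
  rwa [NormedSpace.exp_zero, sub_zero, norm_zero, max_eq_left (norm_nonneg X)] at h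

variable {ι : Type*}

/-- `‖e^{A ν i} − 1‖ ≤ dl ‖A‖` (Pi-sup norm). [folklore] -/
theorem norm_mexp_coord_sub_one_le [Fintype ι] (A : Fin d → ι → Matrix o o ℂ) (ν : Fin d) (i : ι) :
    ‖NormedSpace.exp (A ν i) - 1‖ ≤ ‖A‖ * Real.exp ‖A‖ := by
  have h : ‖A ν i‖ ≤ ‖A‖ := (norm_le_pi_norm (A ν) i).trans (norm_le_pi_norm A ν)
  exact (norm_mexp_sub_one_le _).trans (mul_le_mul h (Real.exp_le_exp.mpr h) (Real.exp_pos _).le (norm_nonneg _))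

/-- `‖e^{−A ν i} − 1‖ ≤ dl ‖A‖`. [folklore] -/
theorem norm_mexp_neg_coord_sub_one_le [Fintype ι] (A : Fin d → ι → Matrix o o ℂ) (ν : Fin d) (i : ι) :
    ‖NormedSpace.exp (-(A ν i)) - 1‖ ≤ ‖A‖ * Real.exp ‖A‖ := by
  have h : ‖A ν i‖ ≤ ‖A‖ := (norm_le_pi_norm (A ν) i).trans (norm_le_pi_norm A ν)
  refine (norm_mexp_sub_one_le _).trans ?_
  rw [norm_neg]
  exact mul_le_mul h (Real.exp_le_exp.mpr h) (Real.exp_pos _).le (norm_nonneg _)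

/-- unitary colour matrices have norm `1`. [folklore] -/
theorem norm_of_unitary {U : Matrix o o ℂ} (hU : U ∈ Matrix.unitaryGroup o ℂ) : ‖U‖ = 1 := CStarRing.norm_of_mem_unitary hU

/-- `‖expChart R⁰ A ν i − R⁰ ν i‖ ≤ dl ‖A‖` (unitary `R⁰`). [folklore] -/
theorem norm_expChart_sub_le [Fintype ι] {R₀ : Fin d → ι → Matrix o o ℂ} (hR₀ : ∀ ν i, R₀ ν i ∈ Matrix.unitaryGroup o ℂ)
    (A : Fin d → ι → Matrix o o ℂ) (ν : Fin d) (i : ι) : ‖expChart R₀ A ν i - R₀ ν i‖ ≤ ‖A‖ * Real.exp ‖A‖ := by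
  rw [expChart_apply, show NormedSpace.exp (A ν i) * R₀ ν i - R₀ ν i = (NormedSpace.exp (A ν i) - 1) * R₀ ν i by rw [Matrix.sub_mul, Matrix.one_mul]]
  exact (Matrix.l2_opNorm_mul _ _).trans (by rw [norm_of_unitary (hR₀ ν i), mul_one]; exact norm_mexp_coord_sub_one_le A ν i)

/-- `‖expChartInv R⁰ A ν i − (adjOf R⁰) ν i‖ ≤ dl ‖A‖` (unitary `R⁰`: `(R⁰)⁻¹ = (R⁰)ᴴ`). [folklore] -/
theorem norm_expChartInv_sub_le [Fintype ι] {R₀ : Fin d → ι → Matrix o o ℂ} (hR₀ : ∀ ν i, R₀ ν i ∈ Matrix.unitaryGroup o ℂ)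
    (A : Fin d → ι → Matrix o o ℂ) (ν : Fin d) (i : ι) : ‖expChartInv R₀ A ν i - adjOf R₀ ν i‖ ≤ ‖A‖ * Real.exp ‖A‖ := by
  rw [adjOf_eq_inv hR₀, expChartInv_apply, show (R₀ ν i)⁻¹ * NormedSpace.exp (-(A ν i)) - (R₀ ν i)⁻¹ = (R₀ ν i)⁻¹ * (NormedSpace.exp (-(A ν i)) - 1) by
    rw [Matrix.mul_sub, Matrix.mul_one]]
  have hinv : ‖(R₀ ν i)⁻¹‖ = 1 := by
    have h := congrArg (fun F => F ν i) (adjOf_eq_inv hR₀)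
    simp only [adjOf_apply] at h
    rw [← h, Matrix.l2_opNorm_conjTranspose, norm_of_unitary (hR₀ ν i)]
  exact (Matrix.l2_opNorm_mul _ _).trans (by rw [hinv, one_mul]; exact norm_mexp_neg_coord_sub_one_le A ν i)

/-- `‖expChart R⁰ A ν i‖ ≤ 1 + dl ‖A‖`. [folklore] -/
theorem norm_expChart_le [Fintype ι] {R₀ : Fin d → ι → Matrix o o ℂ} (hR₀ : ∀ ν i, R₀ ν i ∈ Matrix.unitaryGroup o ℂ)
    (A : Fin d → ι → Matrix o o ℂ) (ν : Fin d) (i : ι) : ‖expChart R₀ A ν i‖ ≤ 1 + ‖A‖ * Real.exp ‖A‖ := by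
  have h := norm_expChart_sub_le hR₀ A ν i
  have h2 : ‖expChart R₀ A ν i‖ ≤ ‖R₀ ν i‖ + ‖expChart R₀ A ν i - R₀ ν i‖ := norm_le_insert' _ _
  rw [norm_of_unitary (hR₀ ν i)] at h2
  linarith

/-! ## §2 Transports and the covariant averaging -/

/-- products along a list (auxiliary conjunction): `‖Π R′‖ ≤ 1` and `‖Π R − Π R′‖ ≤ (1 + δ)^ℓ − 1`. [folklore] -/
theorem norm_list_prod_sub_prod_aux (l : List ι) (f g : ι → Matrix o o ℂ) {δ : ℝ} (hδ : 0 ≤ δ) (hg : ∀ b ∈ l, ‖g b‖ ≤ 1)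
    (hfg : ∀ b ∈ l, ‖f b - g b‖ ≤ δ) : ‖(l.map g).prod‖ ≤ 1 ∧ ‖(l.map f).prod - (l.map g).prod‖ ≤ (1 + δ) ^ l.length - 1 := by
  induction l with
  | nil => simp
  | cons b l ih =>
    have hgl : ∀ x ∈ l, ‖g x‖ ≤ 1 := fun x hx => hg x (List.mem_cons_of_mem _ hx)
    have hfl : ∀ x ∈ l, ‖f x - g x‖ ≤ δ := fun x hx => hfg x (List.mem_cons_of_mem _ hx)
    obtain ⟨hPg, hdiff⟩ := ih hgl hfl
    have hgb : ‖g b‖ ≤ 1 := hg b List.mem_cons_self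
    have hfb : ‖f b - g b‖ ≤ δ := hfg b List.mem_cons_self
    have hpow : 0 ≤ (1 + δ) ^ l.length := pow_nonneg (by linarith) _
    have hPf : ‖(l.map f).prod‖ ≤ (1 + δ) ^ l.length := by
      have h : ‖(l.map f).prod‖ ≤ ‖(l.map g).prod‖ + ‖(l.map f).prod - (l.map g).prod‖ := norm_le_insert' _ _
      linarith
    simp only [List.map_cons, List.prod_cons, List.length_cons]
    refine ⟨(Matrix.l2_opNorm_mul _ _).trans ((mul_le_mul hgb hPg (norm_nonneg _) zero_le_one).trans (by rw [one_mul])), ?_⟩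
    rw [show f b * (l.map f).prod - g b * (l.map g).prod = (f b - g b) * (l.map f).prod + g b * ((l.map f).prod - (l.map g).prod) by
      simp only [Matrix.sub_mul, Matrix.mul_sub]; abel]
    calc _ ≤ ‖(f b - g b) * (l.map f).prod‖ + ‖g b * ((l.map f).prod - (l.map g).prod)‖ := norm_add_le _ _
      _ ≤ δ * (1 + δ) ^ l.length + 1 * ((1 + δ) ^ l.length - 1) :=
          add_le_add ((Matrix.l2_opNorm_mul _ _).trans (mul_le_mul hfb hPf (norm_nonneg _) hδ))
            ((Matrix.l2_opNorm_mul _ _).trans (mul_le_mul hgb hdiff (norm_nonneg _) zero_le_one))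
      _ = (1 + δ) ^ (l.length + 1) - 1 := by ring

/-- a product of factors of norm `≤ 1` has norm `≤ 1`. [folklore] -/
theorem norm_list_prod_le_one (l : List ι) (g : ι → Matrix o o ℂ) (hg : ∀ b ∈ l, ‖g b‖ ≤ 1) : ‖(l.map g).prod‖ ≤ 1 :=
  (norm_list_prod_sub_prod_aux l g g le_rfl hg (fun b _ => by rw [sub_self, norm_zero])).1

variable (Nf : Fin d → ℕ) [hNf : ∀ μ, NeZero (Nf μ)]

omit hNf in
/-- **transport difference**: if the reference transporters have norm `≤ 1` and `‖R b − R′ b‖ ≤ δ` on every bond, then along a list of length `≤ ℓ`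
`‖transport R − transport R′‖ ≤ (1 + δ)^ℓ − 1`. [folklore] -/
theorem norm_transport_sub_transport_le {R R' : Fin d → (Tor Nf × Fin d → Matrix o o ℂ)} {δ : ℝ} (hδ : 0 ≤ δ) (hR' : ∀ ν i, ‖R' ν i‖ ≤ 1)
    (hRR' : ∀ ν i, ‖R ν i - R' ν i‖ ≤ δ) (μ : Fin d) {L : List (Tor Nf × Fin d)} {ℓ : ℕ} (hL : L.length ≤ ℓ) :
    ‖transport Nf R μ L - transport Nf R' μ L‖ ≤ (1 + δ) ^ ℓ - 1 := by
  have h := (norm_list_prod_sub_prod_aux L (fun b : Tor Nf × Fin d => R b.2 (b.1, μ)) (fun b : Tor Nf × Fin d => R' b.2 (b.1, μ)) hδ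
    (fun b _ => hR' b.2 (b.1, μ)) (fun b _ => hRR' b.2 (b.1, μ))).2
  have hmono : (1 + δ) ^ L.length - 1 ≤ (1 + δ) ^ ℓ - 1 := sub_le_sub_right (pow_le_pow_right₀ (by linarith) hL) 1
  rw [transport, transport]
  exact h.trans hmono

omit hNf in
/-- transports of transporters of norm `≤ 1` have norm `≤ 1`. [folklore] -/
theorem norm_transport_le_one {R' : Fin d → (Tor Nf × Fin d → Matrix o o ℂ)} (hR' : ∀ ν i, ‖R' ν i‖ ≤ 1) (μ : Fin d) (L : List (Tor Nf × Fin d)) :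
    ‖transport Nf R' μ L‖ ≤ 1 := by
  have h := norm_list_prod_le_one L (fun b : Tor Nf × Fin d => R' b.2 (b.1, μ)) (fun b _ => hR' b.2 (b.1, μ))
  rw [transport]
  exact h

variable (n : ℕ) [NeZero n] (M : Fin d → ℕ) [hM : ∀ μ, NeZero (M μ)]

omit [Nonempty o] [NeZero n] hM in
/-- the entries of a difference of two covariant averagings. [folklore] -/
theorem Qcov_sub_Qcov_apply (Γ : ContourSystem d n M) (R R' : Fin d → (Tor (fine n M) × Fin d → Matrix o o ℂ))
    (b : (Tor M × Fin d) × o) (i : (Tor (fine n M) × Fin d) × o) :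
    (Qcov n M Γ R - Qcov n M Γ R') b i
      = if i.1.2 = b.1.2 then
          ∑ j : Fin d → Fin n, ∑ t : Fin n,
            (if i.1.1 = bpt n M b.1.1 j + tstep (fine n M) b.1.2 t then
              (1 / (n : ℂ) ^ (d + 1)) * (transport (fine n M) R b.1.2 (Γ b.1.1 j b.1.2 t) - transport (fine n M) R' b.1.2 (Γ b.1.1 j b.1.2 t)) b.2 i.2
             else 0)
        else 0 := by
  rw [Matrix.sub_apply]
  simp only [Qcov]
  by_cases h : i.1.2 = b.1.2
  · rw [if_pos h, if_pos h, if_pos h, ← Finset.sum_sub_distrib]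
    refine Finset.sum_congr rfl fun j _ => ?_
    rw [← Finset.sum_sub_distrib]
    refine Finset.sum_congr rfl fun t _ => ?_
    split_ifs
    · rw [Matrix.sub_apply, mul_sub]
    · rw [sub_zero]
  · rw [if_neg h, if_neg h, if_neg h, sub_zero]

omit [Nonempty o] [NeZero n] hM in
/-- entry law: a uniform contour-transport difference `ε` bounds the entries by `ε·qr`. [folklore] -/
theorem norm_Qcov_sub_Qcov_apply_le (Γ : ContourSystem d n M) {R R' : Fin d → (Tor (fine n M) × Fin d → Matrix o o ℂ)} {ε : ℝ} (hε : 0 ≤ ε)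
    (hT : ∀ y j μ (t : Fin n), ‖transport (fine n M) R μ (Γ y j μ t) - transport (fine n M) R' μ (Γ y j μ t)‖ ≤ ε)
    (b : (Tor M × Fin d) × o) (i : (Tor (fine n M) × Fin d) × o) :
    ‖(Qcov n M Γ R - Qcov n M Γ R') b i‖ ≤ ε * qr n M b.1 i.1 := by
  rw [Qcov_sub_Qcov_apply]
  by_cases h : i.1.2 = b.1.2
  · rw [if_pos h]
    have hqr : qr n M b.1 i.1 = ∑ j : Fin d → Fin n, ∑ t : Fin n,
        (if i.1.1 = bpt n M b.1.1 j + tstep (fine n M) b.1.2 t then 1 / (n : ℝ) ^ (d + 1) else 0) := by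
      rw [qr]
      refine Finset.sum_congr rfl fun j _ => Finset.sum_congr rfl fun t _ => ?_
      have hiff : i.1 = (bpt n M b.1.1 j + tstep (fine n M) b.1.2 t, b.1.2) ↔ i.1.1 = bpt n M b.1.1 j + tstep (fine n M) b.1.2 t :=
        ⟨fun hi => by rw [hi], fun hi => Prod.ext hi h⟩
      by_cases hc : i.1.1 = bpt n M b.1.1 j + tstep (fine n M) b.1.2 t
      · rw [if_pos hc, if_pos (hiff.mpr hc)]
      · rw [if_neg hc, if_neg (fun h' => hc (hiff.mp h'))]
    rw [hqr, Finset.mul_sum]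
    refine (norm_sum_le _ _).trans (Finset.sum_le_sum fun j _ => ?_)
    rw [Finset.mul_sum]
    refine (norm_sum_le _ _).trans (Finset.sum_le_sum fun t _ => ?_)
    split_ifs
    · rw [norm_mul, norm_div, norm_one, norm_pow, Complex.norm_natCast, mul_comm]
      exact mul_le_mul_of_nonneg_right ((norm_entry_le_opNorm _ _ _).trans (hT _ _ _ _)) (by positivity)
    · simp
  · rw [if_neg h, norm_zero]
    exact mul_nonneg hε (qr_nonneg n M b.1 i.1)

omit [Nonempty o] in
/-- **`‖Q(R) − Q(R′)‖ ≤ |o|·ε·n^{−d/2}`** (rectangular Schur test on the `qr` pattern). [folklore] -/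
theorem opNorm_Qcov_sub_Qcov_le (Γ : ContourSystem d n M) {R R' : Fin d → (Tor (fine n M) × Fin d → Matrix o o ℂ)} {ε : ℝ} (hε : 0 ≤ ε)
    (hT : ∀ y j μ (t : Fin n), ‖transport (fine n M) R μ (Γ y j μ t) - transport (fine n M) R' μ (Γ y j μ t)‖ ≤ ε) :
    ‖Qcov n M Γ R - Qcov n M Γ R'‖ ≤ Fintype.card o * ε * (Real.sqrt ((n : ℝ) ^ d))⁻¹ := by
  have hn : (0 : ℝ) < (n : ℝ) ^ d := pow_pos (by exact_mod_cast Nat.pos_of_ne_zero (NeZero.ne n)) d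
  have hco : (0 : ℝ) ≤ Fintype.card o := Nat.cast_nonneg _
  have hrow : ∀ b : (Tor M × Fin d) × o, ∑ i : (Tor (fine n M) × Fin d) × o, ‖(Qcov n M Γ R - Qcov n M Γ R') b i‖ ≤ Fintype.card o * ε := by
    intro b
    calc _ ≤ ∑ i : (Tor (fine n M) × Fin d) × o, ε * qr n M b.1 i.1 := Finset.sum_le_sum fun i _ => norm_Qcov_sub_Qcov_apply_le n M Γ hε hT b i
      _ = Fintype.card o * ε := by
          rw [Fintype.sum_prod_type, Finset.sum_comm]
          simp only [Finset.sum_const, Finset.card_univ, nsmul_eq_mul, ← Finset.mul_sum]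
          rw [sum_qr_row, mul_one]
  have hcol : ∀ i : (Tor (fine n M) × Fin d) × o, ∑ b : (Tor M × Fin d) × o, ‖(Qcov n M Γ R - Qcov n M Γ R') b i‖
      ≤ Fintype.card o * ε * (1 / (n : ℝ) ^ d) := by
    intro i
    calc _ ≤ ∑ b : (Tor M × Fin d) × o, ε * qr n M b.1 i.1 := Finset.sum_le_sum fun b _ => norm_Qcov_sub_Qcov_apply_le n M Γ hε hT b i
      _ = Fintype.card o * ε * (1 / (n : ℝ) ^ d) := by
          rw [Fintype.sum_prod_type, Finset.sum_comm]
          simp only [Finset.sum_const, Finset.card_univ, nsmul_eq_mul, ← Finset.mul_sum]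
          rw [sum_qr_col, mul_assoc]
  refine (opNorm_le_sqrt_of_schur _ (by positivity) (by positivity) hrow hcol).trans (le_of_eq ?_)
  rw [show (Fintype.card o : ℝ) * ε * (Fintype.card o * ε * (1 / (n : ℝ) ^ d)) = (Fintype.card o * ε) ^ 2 * ((n : ℝ) ^ d)⁻¹ by ring,
    Real.sqrt_mul (sq_nonneg _), Real.sqrt_sq (by positivity), Real.sqrt_inv]

/-- **`‖Q(R′)‖ ≤ (2|o| + 1)·n^{−d/2}`** for transporters of norm `≤ 1` (every contour transport is within `2` of the identity). [folklore] -/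
theorem opNorm_Qcov_le_of_norm_le_one (Γ : ContourSystem d n M) {R' : Fin d → (Tor (fine n M) × Fin d → Matrix o o ℂ)} (hR' : ∀ ν i, ‖R' ν i‖ ≤ 1) :
    ‖Qcov n M Γ R'‖ ≤ (2 * Fintype.card o + 1) * (Real.sqrt ((n : ℝ) ^ d))⁻¹ := by
  have hT : ∀ y j μ (t : Fin n), ‖transport (fine n M) R' μ (Γ y j μ t) - 1‖ ≤ 2 := by
    intro y j μ t
    have h1 : ‖transport (fine n M) R' μ (Γ y j μ t)‖ ≤ 1 := norm_transport_le_one (fine n M) hR' μ _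
    calc _ ≤ ‖transport (fine n M) R' μ (Γ y j μ t)‖ + ‖(1 : Matrix o o ℂ)‖ := norm_sub_le _ _
      _ ≤ 1 + 1 := add_le_add h1 (by rw [norm_one])
      _ = 2 := by norm_num
  have h := opNorm_Qcov_sub_kron_le n M Γ zero_le_two hT
  have hQ1 : ‖QvOp n M ⊗ₖ (1 : Matrix o o ℂ)‖ ≤ (Real.sqrt ((n : ℝ) ^ d))⁻¹ := opNorm_kron_le_of_le o (opNorm_QvOp_le n M)
  calc ‖Qcov n M Γ R'‖ = ‖(Qcov n M Γ R' - QvOp n M ⊗ₖ (1 : Matrix o o ℂ)) + QvOp n M ⊗ₖ (1 : Matrix o o ℂ)‖ := by rw [sub_add_cancel]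
    _ ≤ ‖Qcov n M Γ R' - QvOp n M ⊗ₖ (1 : Matrix o o ℂ)‖ + ‖QvOp n M ⊗ₖ (1 : Matrix o o ℂ)‖ := norm_add_le _ _
    _ ≤ Fintype.card o * 2 * (Real.sqrt ((n : ℝ) ^ d))⁻¹ + (Real.sqrt ((n : ℝ) ^ d))⁻¹ := add_le_add h hQ1
    _ = (2 * Fintype.card o + 1) * (Real.sqrt ((n : ℝ) ^ d))⁻¹ := by ring

/-! ## §3 The covariant differences -/

omit [Nonempty o] in
/-- `‖K_ν ⊗ 1‖ ≤ 1` for the bond translation. [folklore] -/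
theorem opNorm_kronShift_le (ν : Fin d) : ‖shiftM Nf ν ⊗ₖ (1 : Matrix o o ℂ)‖ ≤ 1 := opNorm_kron_le_of_le o (opNorm_shiftM_le _ ν)

omit [Nonempty o] in
/-- **`‖∇(R) − ∇(R′)‖ ≤ ‖c‖·δ`** when `‖R ν i − R′ ν i‖ ≤ δ`. [folklore] -/
theorem opNorm_covDc_sub_le (c : ℂ) {R R' : Fin d → (Tor Nf × Fin d → Matrix o o ℂ)} (ν : Fin d) {δ : ℝ} (hδ : 0 ≤ δ)
    (hRR' : ∀ i, ‖R ν i - R' ν i‖ ≤ δ) : ‖covDc Nf c R ν - covDc Nf c R' ν‖ ≤ ‖c‖ * δ := by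
  have e : covDc Nf c R ν - covDc Nf c R' ν = c • (siteMul (fun i => R ν i - R' ν i) * shiftM Nf ν ⊗ₖ (1 : Matrix o o ℂ)) := by
    rw [covDc, covDc, ← smul_sub, sub_sub_sub_cancel_right, ← Matrix.sub_mul, ← siteMul_sub]
  rw [e, norm_smul]
  refine mul_le_mul_of_nonneg_left ((Matrix.l2_opNorm_mul _ _).trans ?_) (norm_nonneg _)
  exact (mul_le_mul (opNorm_siteMul_le _ hδ hRR') (opNorm_kronShift_le Nf ν) (norm_nonneg _) hδ).trans (by rw [mul_one])

omit [Nonempty o] in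
/-- **`‖∇ᴬ(S) − ∇ᴬ(S′)‖ ≤ ‖c‖·δ`** when `‖S ν i − S′ ν i‖ ≤ δ`. [folklore] -/
theorem opNorm_covDcA_sub_le (c : ℂ) {S S' : Fin d → (Tor Nf × Fin d → Matrix o o ℂ)} (ν : Fin d) {δ : ℝ} (hδ : 0 ≤ δ)
    (hSS' : ∀ i, ‖S ν i - S' ν i‖ ≤ δ) : ‖covDcA Nf c S ν - covDcA Nf c S' ν‖ ≤ ‖c‖ * δ := by
  have e : covDcA Nf c S ν - covDcA Nf c S' ν = (starRingEnd ℂ) c • ((shiftM Nf ν ⊗ₖ (1 : Matrix o o ℂ))ᴴ * siteMul (fun i => S ν i - S' ν i)) := by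
    rw [covDcA, covDcA, ← smul_sub, sub_sub_sub_cancel_right, ← Matrix.mul_sub, ← siteMul_sub]
  rw [e, norm_smul, Complex.norm_conj]
  refine mul_le_mul_of_nonneg_left ((Matrix.l2_opNorm_mul _ _).trans ?_) (norm_nonneg _)
  rw [Matrix.l2_opNorm_conjTranspose]
  exact (mul_le_mul (opNorm_kronShift_le Nf ν) (opNorm_siteMul_le _ hδ hSS') (norm_nonneg _) zero_le_one).trans (by rw [one_mul])

/-- `‖1‖ ≤ 1` on coloured bond fields (as `siteMul` of colour identities; no `Nonempty` hypothesis on the bond index). [folklore] -/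
theorem norm_one_site_le : ‖(1 : Matrix ((Tor Nf × Fin d) × o) ((Tor Nf × Fin d) × o) ℂ)‖ ≤ 1 := by
  rw [← siteMul_one]; exact opNorm_siteMul_le _ zero_le_one (fun _ => norm_one.le)

/-- `‖∇(R)‖ ≤ ‖c‖·(β + 1)` when `‖R ν i‖ ≤ β`. [folklore] -/
theorem opNorm_covDc_le (c : ℂ) {R : Fin d → (Tor Nf × Fin d → Matrix o o ℂ)} (ν : Fin d) {β : ℝ} (hβ : 0 ≤ β) (hR : ∀ i, ‖R ν i‖ ≤ β) :
    ‖covDc Nf c R ν‖ ≤ ‖c‖ * (β + 1) := by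
  rw [covDc, norm_smul]
  refine mul_le_mul_of_nonneg_left ((norm_sub_le _ _).trans (add_le_add ((Matrix.l2_opNorm_mul _ _).trans ?_) (norm_one_site_le Nf))) (norm_nonneg _)
  exact (mul_le_mul (opNorm_siteMul_le _ hβ hR) (opNorm_kronShift_le Nf ν) (norm_nonneg _) hβ).trans (by rw [mul_one])

/-- `‖∇ᴬ(S)‖ ≤ ‖c‖·(β + 1)` when `‖S ν i‖ ≤ β`. [folklore] -/
theorem opNorm_covDcA_le (c : ℂ) {S : Fin d → (Tor Nf × Fin d → Matrix o o ℂ)} (ν : Fin d) {β : ℝ} (hβ : 0 ≤ β) (hS : ∀ i, ‖S ν i‖ ≤ β) :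
    ‖covDcA Nf c S ν‖ ≤ ‖c‖ * (β + 1) := by
  rw [covDcA, norm_smul, Complex.norm_conj]
  refine mul_le_mul_of_nonneg_left ((norm_sub_le _ _).trans (add_le_add ((Matrix.l2_opNorm_mul _ _).trans ?_) (norm_one_site_le Nf))) (norm_nonneg _)
  rw [Matrix.l2_opNorm_conjTranspose]
  exact (mul_le_mul (opNorm_kronShift_le Nf ν) (opNorm_siteMul_le _ hβ hS) (norm_nonneg _) zero_le_one).trans (by rw [one_mul])

/-- **THE COVARIANT-LAPLACIAN DIFFERENCE**: `‖Δ(R, S) − Δ(R′, S′)‖ ≤ d·‖c‖²·δ·(β + 3)` when `‖R‖ ≤ β`, `‖S′‖ ≤ 1`, `‖R − R′‖, ‖S − S′‖ ≤ δ` bondwise. [folklore] -/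
theorem opNorm_covLapT_sub_le (c : ℂ) {R R' S S' : Fin d → (Tor Nf × Fin d → Matrix o o ℂ)} {β δ : ℝ} (hβ : 0 ≤ β) (hδ : 0 ≤ δ)
    (hR : ∀ ν i, ‖R ν i‖ ≤ β) (hS' : ∀ ν i, ‖S' ν i‖ ≤ 1) (hRR' : ∀ ν i, ‖R ν i - R' ν i‖ ≤ δ) (hSS' : ∀ ν i, ‖S ν i - S' ν i‖ ≤ δ) :
    ‖covLapT Nf c R S - covLapT Nf c R' S'‖ ≤ d * ‖c‖ ^ 2 * δ * (β + 3) := by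
  rw [covLapT, covLapT, ← Finset.sum_sub_distrib]
  refine (norm_sum_le _ _).trans ?_
  have hterm : ∀ ν ∈ (Finset.univ : Finset (Fin d)), ‖covDcA Nf c S ν * covDc Nf c R ν - covDcA Nf c S' ν * covDc Nf c R' ν‖ ≤ ‖c‖ ^ 2 * δ * (β + 3) := by
    intro ν _
    rw [show covDcA Nf c S ν * covDc Nf c R ν - covDcA Nf c S' ν * covDc Nf c R' ν
        = (covDcA Nf c S ν - covDcA Nf c S' ν) * covDc Nf c R ν + covDcA Nf c S' ν * (covDc Nf c R ν - covDc Nf c R' ν) by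
      simp only [Matrix.sub_mul, Matrix.mul_sub]; abel]
    calc _ ≤ ‖(covDcA Nf c S ν - covDcA Nf c S' ν) * covDc Nf c R ν‖ + ‖covDcA Nf c S' ν * (covDc Nf c R ν - covDc Nf c R' ν)‖ := norm_add_le _ _
      _ ≤ ‖c‖ * δ * (‖c‖ * (β + 1)) + ‖c‖ * (1 + 1) * (‖c‖ * δ) :=
          add_le_add ((Matrix.l2_opNorm_mul _ _).trans (mul_le_mul (opNorm_covDcA_sub_le Nf c ν hδ (hSS' ν)) (opNorm_covDc_le Nf c ν hβ (hR ν))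
              (norm_nonneg _) (by positivity)))
            ((Matrix.l2_opNorm_mul _ _).trans (mul_le_mul (opNorm_covDcA_le Nf c ν zero_le_one (hS' ν)) (opNorm_covDc_sub_le Nf c ν hδ (hRR' ν))
              (norm_nonneg _) (by positivity)))
      _ = ‖c‖ ^ 2 * δ * (β + 3) := by ring
  refine (Finset.sum_le_sum hterm).trans (le_of_eq ?_)
  rw [Finset.sum_const, Finset.card_univ, Fintype.card_fin, nsmul_eq_mul]; ring

end Summit.QuantumFields.BalabanUV.T4Continuum.CovariantVectorChartModulus

end
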